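import Mathlib
import Summits.KontsevichZagierPeriods.KontsevichZagierPeriods.Theorems.InverseLandauTateFamilyKernelStubHyperoctahedral
import Summits.KontsevichZagierPeriods.KontsevichZagierPeriods.Theorems.InverseLandauTateFamilyKernelStubAssembly
import Summits.KontsevichZagierPeriods.KontsevichZagierPeriods.Theorems.InverseLandauTateFamilyKernelStubOddIntegral
import Summits.KontsevichZagierPeriods.KontsevichZagierPeriods.Theorems.InverseLandauTateFamilyKernelStubBoundaryFamily
import Summits.KontsevichZagierPeriods.KontsevichZagierPeriods.Theorems.InverseLandauTateFamilyKernelStubLinMoments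

/-!
# Crux `TateFamilyKernel` (stmt-KontsevichZagierPeriods-9130), line `Sketch` — stub `stub_sfEvenOdd`

Even/odd bookkeeping for the SYMMETRIC-FOLD LINEAR CLASS of the lead's skeleton of the crux
`Summit.KontsevichZagierPeriods.KontsevichZagierPeriods.Theses.InverseLandau.TateFamilyKernel`
(route `InverseLandau`): dimension `2`, Tate denominator `Q = 1 − ϖ z₁(1−z₁)(α + βz₂)`
(`X 0 = z₁`, `X 1 = z₂`, `X (Fin.last 2) = ϖ`), which is invariant under the box reflection
`g : z₁ ↦ 1 − z₁` of the square. For any numerator `P ∈ ℚ[z₁, z₂]` put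
`P_e = ½ (P + P ∘ g)` (`aeval ![1 - X 0, X 1]` is the substitution `P ↦ P ∘ g`). Then

* (i) `P_e ∘ g = P_e` (substitution is functorial, `MvPolynomial.comp_aeval_apply`, and `g² = 1`;
  the sliced `ϖ`-free numerator is read through `LinMoments.aeval_snoc_rename_castSucc`, p141771);
* (ii) if the family `P/Q` has identically vanishing open-square integrals on `(0,b)`, so does
  `P_e/Q`: the open square and the closed square `KZ.cube 2` carry the same integrals
  (`setIntegral_pi_Ioo_eq_setIntegral_cube'`), the closed-square integral is `g`-invariant for
  every integrand (`setIntegral_cube_comp_reflect`, p137539), and the two integrands are continuous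
  on the compact closed square (`Q ≠ 0` there), hence integrable, so linearity applies;
* (iii) if every tame cube representation of the fibre `P_e/Q(·,ϖ₀)` is a relation, so is every
  tame cube representation of the fibre `P/Q(·,ϖ₀)`: pointwise on the cube
  `P/Q = P_e/Q + (h − h ∘ g)` with `h = P/(2Q)(·,ϖ₀)` tame (`analyticOnNhd_slice`,
  `isSemialgebraicFunOn_slice` at the real-algebraic `ϖ₀`), the term `h − h ∘ g` is a rule-(2)
  relation (`tame_sub_boxReflection_mem_relations`), and the two are glued by rule (1)
  (`tame_add_sum_mem_relations`, p115107).

References: Kontsevich–Zagier 2001, §1.2 rules (1)–(2). No named fact, no new definition.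
-/

noncomputable section

open MeasureTheory Set MvPolynomial
open Literature.NumberTheory.Transcendental

namespace Summit.KontsevichZagierPeriods.InverseLandau.TateFamilyKernel.Descent

namespace SfEvenOdd

/-! ### Evaluations -/

/-- The box reflection `z₁ ↦ 1 − z₁` of the square in matrix notation. [folklore] -/
theorem boxReflection_zero_eq (z : Fin 2 → ℝ) : KZ.boxReflection 0 z = ![1 - z 0, z 1] := by
  funext i
  fin_cases i
  · simp [KZ.boxReflection]
  · simp [KZ.boxReflection]

/-- The substitution `z₁ ↦ 1 − z₁` commutes with evaluation:
`(P ∘ g)(z) = P(g z)`. [folklore] -/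
theorem aeval_aeval_reflect (P : MvPolynomial (Fin 2) ℚ) (z : Fin 2 → ℝ) :
    aeval z (aeval ![1 - X 0, X 1] P : MvPolynomial (Fin 2) ℚ) = aeval (KZ.boxReflection 0 z) P := by
  have hf : (fun i => aeval z (![1 - X 0, X 1] i : MvPolynomial (Fin 2) ℚ)) = ![1 - z 0, z 1] := by
    funext i
    fin_cases i
    · simp
    · simp
  rw [comp_aeval_apply, hf, boxReflection_zero_eq]

/-- The symmetric-fold Tate denominator at `(z, ϖ)`: `Q(z, ϖ) = 1 − ϖ z₁(1−z₁)(α + βz₂)`.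
[folklore] -/
theorem aeval_snoc_sfDen (α β : ℚ) (z : Fin 2 → ℝ) (ϖ : ℝ) :
    aeval (Fin.snoc z ϖ : Fin (2 + 1) → ℝ)
        (1 - X (Fin.last 2) * (X 0 * (1 - X 0)) * (C α + C β * X 1) : MvPolynomial (Fin (2 + 1)) ℚ) =
      1 - ϖ * (z 0 * (1 - z 0)) * ((α : ℝ) + β * z 1) := by
  have h0 : (Fin.snoc z ϖ : Fin (2 + 1) → ℝ) 0 = z 0 := rfl
  have h1 : (Fin.snoc z ϖ : Fin (2 + 1) → ℝ) 1 = z 1 := rfl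
  simp only [map_sub, map_one, map_mul, map_add, aeval_X, aeval_C, Fin.snoc_last, h0, h1,
    eq_ratCast]

/-- The symmetric-fold Tate denominator is invariant under `z₁ ↦ 1 − z₁`. [folklore] -/
theorem aeval_snoc_sfDen_boxReflection (α β : ℚ) (z : Fin 2 → ℝ) (ϖ : ℝ) :
    aeval (Fin.snoc (KZ.boxReflection 0 z) ϖ : Fin (2 + 1) → ℝ)
        (1 - X (Fin.last 2) * (X 0 * (1 - X 0)) * (C α + C β * X 1) : MvPolynomial (Fin (2 + 1)) ℚ) =
      aeval (Fin.snoc z ϖ : Fin (2 + 1) → ℝ)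
        (1 - X (Fin.last 2) * (X 0 * (1 - X 0)) * (C α + C β * X 1) : MvPolynomial (Fin (2 + 1)) ℚ) := by
  rw [aeval_snoc_sfDen, aeval_snoc_sfDen, boxReflection_zero_eq]
  simp only [Matrix.cons_val_zero, Matrix.cons_val_one]
  ring

/-- The even part at a point: `P_e(z) = ½ (P(z) + P(g z))`. [folklore] -/
theorem aeval_evenPart (P : MvPolynomial (Fin 2) ℚ) (z : Fin 2 → ℝ) :
    aeval z (C (1 / 2 : ℚ) * (P + aeval ![1 - X 0, X 1] P)) =
      (1 / 2 : ℝ) * (aeval z P + aeval (KZ.boxReflection 0 z) P) := by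
  rw [map_mul, map_add, aeval_C, aeval_aeval_reflect, eq_ratCast]
  push_cast
  ring

/-- The numerator of `h = P/(2Q)` at a point: `(½ P)(z, ϖ) = ½ P(z)`. [folklore] -/
theorem aeval_snoc_half_mul (P : MvPolynomial (Fin 2) ℚ) (z : Fin 2 → ℝ) (ϖ : ℝ) :
    aeval (Fin.snoc z ϖ : Fin (2 + 1) → ℝ) (C (1 / 2 : ℚ) * rename Fin.castSucc P) =
      (1 / 2 : ℝ) * aeval z P := by
  rw [map_mul, aeval_C, LinMoments.aeval_snoc_rename_castSucc, eq_ratCast]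
  push_cast
  ring

/-! ### The reflection `z₁ ↦ 1 − z₁` and the closed-square integral -/

/-- The closed-square integral is invariant under `z₁ ↦ 1 − z₁`, for every integrand
(`setIntegral_cube_comp_reflect` with `S = {0}`). [folklore] -/
theorem setIntegral_cube_comp_boxReflection_zero (F : (Fin 2 → ℝ) → ℝ) :
    ∫ w in KZ.cube 2, F (KZ.boxReflection 0 w) = ∫ w in KZ.cube 2, F w := by
  have hpt : ∀ w : Fin 2 → ℝ,
      KZ.boxReflection 0 w = fun t => if t ∈ ({0} : Finset (Fin 2)) then 1 - w t else w t := by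
    intro w
    funext t
    fin_cases t
    · simp [KZ.boxReflection]
    · simp [KZ.boxReflection]
  calc ∫ w in KZ.cube 2, F (KZ.boxReflection 0 w)
      = ∫ w in KZ.cube 2, F (fun t => if t ∈ ({0} : Finset (Fin 2)) then 1 - w t else w t) :=
        setIntegral_congr_fun KZ.measurableSet_cube fun w _ => by rw [hpt w]
    _ = ∫ w in KZ.cube 2, F w := setIntegral_cube_comp_reflect {0} F

/-- The closed-square integral of a slice `A/B(·, ϖ)` is invariant under `z₁ ↦ 1 − z₁`.
[folklore] -/
theorem setIntegral_cube_slice_comp_boxReflection_zero (A B : MvPolynomial (Fin (2 + 1)) ℚ) (ϖ : ℝ) :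
    ∫ w in KZ.cube 2, aeval (Fin.snoc (KZ.boxReflection 0 w) ϖ : Fin (2 + 1) → ℝ) A /
        aeval (Fin.snoc (KZ.boxReflection 0 w) ϖ : Fin (2 + 1) → ℝ) B =
      ∫ w in KZ.cube 2, aeval (Fin.snoc w ϖ : Fin (2 + 1) → ℝ) A /
        aeval (Fin.snoc w ϖ : Fin (2 + 1) → ℝ) B :=
  setIntegral_cube_comp_boxReflection_zero fun w =>
    aeval (Fin.snoc w ϖ : Fin (2 + 1) → ℝ) A / aeval (Fin.snoc w ϖ : Fin (2 + 1) → ℝ) B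

/-! ### Pointwise identities -/

/-- (ii), pointwise: `P_e/Q (z, ϖ) = ½ (F(z) + F(g z))` with `F = P/Q(·, ϖ)` and `g : z₁ ↦ 1 − z₁`
(`Q` is `g`-invariant). [folklore] -/
theorem evenPart_div_eq (α β : ℚ) (P : MvPolynomial (Fin 2) ℚ) (z : Fin 2 → ℝ) (ϖ : ℝ) :
    aeval (Fin.snoc z ϖ : Fin (2 + 1) → ℝ)
          (rename Fin.castSucc (C (1 / 2 : ℚ) * (P + aeval ![1 - X 0, X 1] P))) /
        aeval (Fin.snoc z ϖ : Fin (2 + 1) → ℝ)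
          (1 - X (Fin.last 2) * (X 0 * (1 - X 0)) * (C α + C β * X 1) : MvPolynomial (Fin (2 + 1)) ℚ) =
      (1 / 2 : ℝ) *
        (aeval (Fin.snoc z ϖ : Fin (2 + 1) → ℝ) (rename Fin.castSucc P) /
            aeval (Fin.snoc z ϖ : Fin (2 + 1) → ℝ)
              (1 - X (Fin.last 2) * (X 0 * (1 - X 0)) * (C α + C β * X 1) : MvPolynomial (Fin (2 + 1)) ℚ) +
          aeval (Fin.snoc (KZ.boxReflection 0 z) ϖ : Fin (2 + 1) → ℝ) (rename Fin.castSucc P) /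
            aeval (Fin.snoc (KZ.boxReflection 0 z) ϖ : Fin (2 + 1) → ℝ)
              (1 - X (Fin.last 2) * (X 0 * (1 - X 0)) * (C α + C β * X 1) : MvPolynomial (Fin (2 + 1)) ℚ)) := by
  rw [LinMoments.aeval_snoc_rename_castSucc, aeval_evenPart, LinMoments.aeval_snoc_rename_castSucc,
    LinMoments.aeval_snoc_rename_castSucc, aeval_snoc_sfDen_boxReflection]
  ring

/-- (iii), pointwise: `P/Q = P_e/Q + (h − h ∘ g)` at the fibre `ϖ₀`, with `h = P/(2Q)(·, ϖ₀)` and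
`g : z₁ ↦ 1 − z₁` (`Q` is `g`-invariant). [folklore] -/
theorem div_eq_evenPart_add (α β : ℚ) (P : MvPolynomial (Fin 2) ℚ) (ϖ₀ : ℝ) (w : Fin 2 → ℝ) :
    aeval w P /
        aeval (Fin.snoc w ϖ₀ : Fin (2 + 1) → ℝ)
          (1 - X (Fin.last 2) * (X 0 * (1 - X 0)) * (C α + C β * X 1) : MvPolynomial (Fin (2 + 1)) ℚ) =
      aeval w (C (1 / 2 : ℚ) * (P + aeval ![1 - X 0, X 1] P)) /
          aeval (Fin.snoc w ϖ₀ : Fin (2 + 1) → ℝ)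
            (1 - X (Fin.last 2) * (X 0 * (1 - X 0)) * (C α + C β * X 1) : MvPolynomial (Fin (2 + 1)) ℚ) +
        ∑ _l ∈ ({()} : Finset Unit),
          (aeval (Fin.snoc w ϖ₀ : Fin (2 + 1) → ℝ) (C (1 / 2 : ℚ) * rename Fin.castSucc P) /
              aeval (Fin.snoc w ϖ₀ : Fin (2 + 1) → ℝ)
                (1 - X (Fin.last 2) * (X 0 * (1 - X 0)) * (C α + C β * X 1) :
                  MvPolynomial (Fin (2 + 1)) ℚ) -
            aeval (Fin.snoc (KZ.boxReflection 0 w) ϖ₀ : Fin (2 + 1) → ℝ)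
                (C (1 / 2 : ℚ) * rename Fin.castSucc P) /
              aeval (Fin.snoc (KZ.boxReflection 0 w) ϖ₀ : Fin (2 + 1) → ℝ)
                (1 - X (Fin.last 2) * (X 0 * (1 - X 0)) * (C α + C β * X 1) :
                  MvPolynomial (Fin (2 + 1)) ℚ)) := by
  rw [Finset.sum_singleton, aeval_evenPart, aeval_snoc_half_mul, aeval_snoc_half_mul,
    aeval_snoc_sfDen_boxReflection]
  ring

/-! ### The three conjuncts -/

/-- (i) The even part `P_e = ½ (P + P ∘ g)` is `g`-even: `P_e (g z) = P_e (z)`. [folklore] -/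
theorem evenPart_even (P : MvPolynomial (Fin 2) ℚ) (z : Fin 2 → ℝ) :
    aeval ![1 - z 0, z 1] (C (1 / 2 : ℚ) * (P + aeval ![1 - X 0, X 1] P)) =
      aeval z (C (1 / 2 : ℚ) * (P + aeval ![1 - X 0, X 1] P)) := by
  rw [aeval_evenPart, aeval_evenPart, ← boxReflection_zero_eq, KZ.boxReflection_boxReflection]
  ring

/-- (ii) If the family `P/Q` (`Q = 1 − ϖ z₁(1−z₁)(α+βz₂)` admissible on `(0,b)`) has identically
vanishing open-square integrals on `(0,b)`, so does the even family `P_e/Q`: the closed square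
carries the same integrals, its integral is invariant under `z₁ ↦ 1 − z₁`, and both integrands are
continuous on the compact closed square, so linearity applies.
[cite: KontsevichZagier2001, §1.2 rule (2)] -/
theorem integral_evenPart_eq_zero (α β : ℚ) (P : MvPolynomial (Fin 2) ℚ) (b : ℝ)
    (hadm : ∀ (z : Fin 2 → ℝ) (ϖ : ℝ), (∀ t, z t ∈ Icc (0 : ℝ) 1) → ϖ ∈ Ioo 0 b →
      aeval (Fin.snoc z ϖ : Fin (2 + 1) → ℝ)
        (1 - X (Fin.last 2) * (X 0 * (1 - X 0)) * (C α + C β * X 1) : MvPolynomial (Fin (2 + 1)) ℚ) ≠ 0)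
    (hvan : ∀ ϖ ∈ Ioo 0 b, ∫ z in Set.pi Set.univ (fun _ : Fin 2 => Ioo (0 : ℝ) 1),
      aeval (Fin.snoc z ϖ : Fin (2 + 1) → ℝ) (rename Fin.castSucc P) /
        aeval (Fin.snoc z ϖ : Fin (2 + 1) → ℝ)
          (1 - X (Fin.last 2) * (X 0 * (1 - X 0)) * (C α + C β * X 1) : MvPolynomial (Fin (2 + 1)) ℚ) = 0) :
    ∀ ϖ ∈ Ioo 0 b, ∫ z in Set.pi Set.univ (fun _ : Fin 2 => Ioo (0 : ℝ) 1),
      aeval (Fin.snoc z ϖ : Fin (2 + 1) → ℝ)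
          (rename Fin.castSucc (C (1 / 2 : ℚ) * (P + aeval ![1 - X 0, X 1] P))) /
        aeval (Fin.snoc z ϖ : Fin (2 + 1) → ℝ)
          (1 - X (Fin.last 2) * (X 0 * (1 - X 0)) * (C α + C β * X 1) : MvPolynomial (Fin (2 + 1)) ℚ) = 0 := by
  intro ϖ hϖ
  -- `Q(·, ϖ) ≠ 0` on the closed square, so `F = P/Q(·, ϖ)` and `F ∘ g` are integrable there
  have hQϖ : ∀ w ∈ KZ.cube 2, aeval (Fin.snoc w ϖ : Fin (2 + 1) → ℝ)
      (1 - X (Fin.last 2) * (X 0 * (1 - X 0)) * (C α + C β * X 1) : MvPolynomial (Fin (2 + 1)) ℚ) ≠ 0 :=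
    fun w hw => hadm w ϖ (fun t => KZ.mem_cube.1 hw t) hϖ
  have hFa := analyticOnNhd_slice (rename Fin.castSucc P) _ ϖ hQϖ
  have hFi := ContinuousOn.integrableOn_compact (μ := volume) KZ.isCompact_cube hFa.continuousOn
  have hFga := analyticOnNhd_comp_boxReflection 0 hFa
  have hFgi := ContinuousOn.integrableOn_compact (μ := volume) KZ.isCompact_cube hFga.continuousOn
  -- pass to the closed square and split
  have hvan' := hvan ϖ hϖ
  rw [setIntegral_pi_Ioo_eq_setIntegral_cube'] at hvan' ⊢
  simp_rw [evenPart_div_eq α β P _ ϖ]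
  rw [integral_const_mul, integral_add hFi hFgi, setIntegral_cube_slice_comp_boxReflection_zero,
    hvan']
  ring

/-- (iii) At a real-algebraic fibre `ϖ₀` with `Q(·, ϖ₀) ≠ 0` on the closed square: if every tame cube
representation of `P_e/Q(·, ϖ₀)` is a relation, so is every tame cube representation of
`P/Q(·, ϖ₀)` — `P/Q = P_e/Q + (h − h ∘ g)`, `h = P/(2Q)(·, ϖ₀)` tame, `h − h ∘ g` a rule-(2) relation
(`tame_sub_boxReflection_mem_relations`), glued by rule (1) (`tame_add_sum_mem_relations`).
[cite: KontsevichZagier2001, §1.2 rules (1)–(2)] -/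
theorem mem_relations_of_evenPart (α β : ℚ) (P : MvPolynomial (Fin 2) ℚ) {ϖ₀ : ℝ}
    (halg : IsAlgebraic ℚ ϖ₀)
    (hQ₀ : ∀ w ∈ KZ.cube 2, aeval (Fin.snoc w ϖ₀ : Fin (2 + 1) → ℝ)
      (1 - X (Fin.last 2) * (X 0 * (1 - X 0)) * (C α + C β * X 1) : MvPolynomial (Fin (2 + 1)) ℚ) ≠ 0)
    (hev : ∀ R : KZ.IntegralRep 2, R.IsTameCube →
      (∀ z ∈ KZ.cube 2, R.integrand z =
        aeval z (C (1 / 2 : ℚ) * (P + aeval ![1 - X 0, X 1] P)) /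
          aeval (Fin.snoc z ϖ₀ : Fin (2 + 1) → ℝ)
            (1 - X (Fin.last 2) * (X 0 * (1 - X 0)) * (C α + C β * X 1) : MvPolynomial (Fin (2 + 1)) ℚ)) →
      KZ.of R ∈ KZ.relations)
    (Φ : KZ.IntegralRep 2) (hΦ : Φ.IsTameCube)
    (hΦi : ∀ z ∈ KZ.cube 2, Φ.integrand z =
      aeval z P /
        aeval (Fin.snoc z ϖ₀ : Fin (2 + 1) → ℝ)
          (1 - X (Fin.last 2) * (X 0 * (1 - X 0)) * (C α + C β * X 1) : MvPolynomial (Fin (2 + 1)) ℚ)) :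
    KZ.of Φ ∈ KZ.relations := by
  -- `h = P/(2Q)(·, ϖ₀)` is tame on the closed square
  have hha := analyticOnNhd_slice (C (1 / 2 : ℚ) * rename Fin.castSucc P) _ ϖ₀ hQ₀
  have hhs := isSemialgebraicFunOn_slice (C (1 / 2 : ℚ) * rename Fin.castSucc P) _ halg hQ₀
  refine tame_add_sum_mem_relations ({()} : Finset Unit) hev
    (H := fun _ w =>
      aeval (Fin.snoc w ϖ₀ : Fin (2 + 1) → ℝ) (C (1 / 2 : ℚ) * rename Fin.castSucc P) /
          aeval (Fin.snoc w ϖ₀ : Fin (2 + 1) → ℝ)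
            (1 - X (Fin.last 2) * (X 0 * (1 - X 0)) * (C α + C β * X 1) : MvPolynomial (Fin (2 + 1)) ℚ) -
        aeval (Fin.snoc (KZ.boxReflection 0 w) ϖ₀ : Fin (2 + 1) → ℝ)
            (C (1 / 2 : ℚ) * rename Fin.castSucc P) /
          aeval (Fin.snoc (KZ.boxReflection 0 w) ϖ₀ : Fin (2 + 1) → ℝ)
            (1 - X (Fin.last 2) * (X 0 * (1 - X 0)) * (C α + C β * X 1) : MvPolynomial (Fin (2 + 1)) ℚ))
    (fun _ _ => hha.sub (analyticOnNhd_comp_boxReflection 0 hha))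
    (fun _ _ => IsSemialgebraicFunOn.sub_holds hhs (isSemialgebraicFunOn_comp_boxReflection 0 hhs))
    (fun _ _ R hR hRi => tame_sub_boxReflection_mem_relations 0 hha hhs R hR hRi) Φ hΦ
    fun w hw => ?_
  rw [hΦi w hw]
  exact div_eq_evenPart_add α β P ϖ₀ w

end SfEvenOdd

open SfEvenOdd in
/-- STUB `stub_sfEvenOdd` of line `Sketch` — **symmetric-fold class, even/odd bookkeeping.** For
`Q = 1 − ϖ z₁(1−z₁)(α+βz₂)` (invariant under `g : z₁ ↦ 1 − z₁`) and any `P`, put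
`P_e := ½(P + P∘g)`. Then (i) `P_e` is `g`-even; (ii) the family `P_e/Q` has identically vanishing
open-square integrals on `(0,b)` whenever `P/Q` has (the square integral is `g`-invariant,
`setIntegral_cube_comp_reflect`); (iii) if every tame representation of the fibre `P_e/Q(·,ϖ₀)` is
a relation then so is every tame representation of the fibre `P/Q(·,ϖ₀)`: `P/Q = P_e/Q + (h − h∘g)`
with `h = P/(2Q)(·,ϖ₀)` tame, a rule-(2) element (`tame_sub_boxReflection_mem_relations`), glued by
rule (1) (`tame_add_sum_mem_relations`). [cite: KontsevichZagier2001, §1.2] -/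
theorem stub_sfEvenOdd (α β : ℚ) (P : MvPolynomial (Fin 2) ℚ) (b : ℝ)
    (hadm : ∀ (z : Fin 2 → ℝ) (ϖ : ℝ), (∀ t, z t ∈ Icc (0 : ℝ) 1) → ϖ ∈ Ioo 0 b →
      aeval (Fin.snoc z ϖ : Fin (2 + 1) → ℝ)
        (1 - X (Fin.last 2) * (X 0 * (1 - X 0)) * (C α + C β * X 1) : MvPolynomial (Fin (2 + 1)) ℚ) ≠ 0)
    (hvan : ∀ ϖ ∈ Ioo 0 b, ∫ z in Set.pi Set.univ (fun _ : Fin 2 => Ioo (0 : ℝ) 1),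
      aeval (Fin.snoc z ϖ : Fin (2 + 1) → ℝ) (rename Fin.castSucc P) /
        aeval (Fin.snoc z ϖ : Fin (2 + 1) → ℝ)
          (1 - X (Fin.last 2) * (X 0 * (1 - X 0)) * (C α + C β * X 1) : MvPolynomial (Fin (2 + 1)) ℚ) = 0)
    (ϖ₀ : ℝ) (halg : IsAlgebraic ℚ ϖ₀) (hϖ₀ : ϖ₀ ∈ Ioo 0 b) :
    (∀ z : Fin 2 → ℝ, aeval ![1 - z 0, z 1] (C (1 / 2 : ℚ) * (P + aeval ![1 - X 0, X 1] P)) =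
        aeval z (C (1 / 2 : ℚ) * (P + aeval ![1 - X 0, X 1] P))) ∧
    (∀ ϖ ∈ Ioo 0 b, ∫ z in Set.pi Set.univ (fun _ : Fin 2 => Ioo (0 : ℝ) 1),
      aeval (Fin.snoc z ϖ : Fin (2 + 1) → ℝ)
          (rename Fin.castSucc (C (1 / 2 : ℚ) * (P + aeval ![1 - X 0, X 1] P))) /
        aeval (Fin.snoc z ϖ : Fin (2 + 1) → ℝ)
          (1 - X (Fin.last 2) * (X 0 * (1 - X 0)) * (C α + C β * X 1) : MvPolynomial (Fin (2 + 1)) ℚ) = 0) ∧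
    ((∀ R : KZ.IntegralRep 2, R.IsTameCube →
        (∀ z ∈ KZ.cube 2, R.integrand z =
          aeval z (C (1 / 2 : ℚ) * (P + aeval ![1 - X 0, X 1] P)) /
            aeval (Fin.snoc z ϖ₀ : Fin (2 + 1) → ℝ)
              (1 - X (Fin.last 2) * (X 0 * (1 - X 0)) * (C α + C β * X 1) : MvPolynomial (Fin (2 + 1)) ℚ)) →
        KZ.of R ∈ KZ.relations) →
      ∀ Φ : KZ.IntegralRep 2, Φ.IsTameCube →
        (∀ z ∈ KZ.cube 2, Φ.integrand z =
          aeval z P /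
            aeval (Fin.snoc z ϖ₀ : Fin (2 + 1) → ℝ)
              (1 - X (Fin.last 2) * (X 0 * (1 - X 0)) * (C α + C β * X 1) : MvPolynomial (Fin (2 + 1)) ℚ)) →
        KZ.of Φ ∈ KZ.relations) :=
  ⟨evenPart_even P, integral_evenPart_eq_zero α β P b hadm hvan,
    fun hev Φ hΦ hΦi => mem_relations_of_evenPart α β P halg
      (fun w hw => hadm w ϖ₀ (fun t => KZ.mem_cube.1 hw t) hϖ₀) hev Φ hΦ hΦi⟩

end Summit.KontsevichZagierPeriods.InverseLandau.TateFamilyKernel.Descent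

end
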